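import Mathlib.Analysis.InnerProductSpace.GramSchmidtOrtho
import Mathlib.Analysis.InnerProductSpace.PiL2
import Mathlib.Analysis.SpecialFunctions.Integrals.Basic
import Mathlib.MeasureTheory.Integral.IntervalIntegral.Basic
import Mathlib.LinearAlgebra.Matrix.Determinant.Basic
import Mathlib.Analysis.Normed.Group.InfiniteSum
import Literature.Analysis.Toeplitz.StrongSzego
import HarnessLib

/-!
# Decay of Toeplitz determinants from an approximate kernel vector

Topic `Analysis/Toeplitz`, namespace `Literature.Analysis.Toeplitz`. An elementary, self-contained
bound on the Toeplitz determinants `D_n(φ) = det (φ_{j-k})_{j,k<n}` of `StrongSzego.lean`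
(Deift–Its–Krasovsky, CPAM 66 (2013), §1, eqs. (1)–(3)) for symbols of NEGATIVE WINDING, in the
form in which it is used to discharge Wu's exponential decay of the Ising row correlation above
`T_c` (`Literature.Probability.LatticeModels.toeplitzDet_onsagerSymbol_exp_decay`, discharged in
`Literature/Probability/LatticeModels/OnsagerToeplitzProofs.lean`):

* `norm_toeplitzDet_mul_norm_le_tsum` — if `φ` is continuous with `|φ| ≤ 1` and
  `H(θ) = ∑_{k ≥ 0} h_k e^{ikθ}` is an absolutely convergent series such that the product `φ H`
  has NO Fourier modes of index `≥ 0`, then for every `n`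

      `|D_n(φ)| · |h_0| ≤ ∑_{k ≥ n} |h_k|`.

  (For a symbol `φ = -e^{-iθ} ψ₊/ψ̄₊` of winding `-1` with `ψ₊` analytic and zero-free on a disc of
  radius `R > 1` one takes `H = 1/ψ₊`, whose coefficients decay like `R^{-k}`, and obtains
  `D_n(φ) = O(R^{-n})` — the classical geometric decay of Toeplitz determinants of symbols with
  nonzero index.) Proof: `(h_0, …, h_{n-1})` is an approximate kernel vector of `T_n(φ)`:
  `T_n(φ) h = ((φ V_n)_j)_{j<n} = -((φ R_n)_j)_{j<n}` with `V_n` the partial sum and `R_n` the tail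
  of the series; replacing the first column of `T_n(φ)` by `T_n(φ) h` multiplies the determinant by
  `h_0` (`Matrix.det_updateCol_sum`), and Hadamard's inequality bounds the new determinant by the
  product of the column norms, which Bessel's inequality bounds by `‖φ R_n‖_{L²} ≤ ∑_{k≥n}|h_k|`
  and by `‖φ‖_{L²} ≤ 1` respectively.
* the tools, all proved here: Hadamard's inequality over `ℂ` (`norm_det_le_prod_norm_col`, from
  Mathlib's Gram–Schmidt), Bessel's inequality for the coefficients `circleCoeff`
  (`two_pi_mul_sum_norm_sq_circleCoeff_le`, by expanding `0 ≤ ∫|f − ∑ f_m e^{imθ}|²`), the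
  vanishing of the nonnegative coefficients of a series in `e^{-i(k+1)θ}`
  (`circleCoeff_natCast_eq_zero_of_hasSum`, termwise integration), and the elementary algebra of
  `circleCoeff` (shift rule, linearity, orthogonality of the exponentials).

No new definitions. Mathlib anchors: `InnerProductSpace.gramSchmidtOrthonormalBasis_det`,
`OrthonormalBasis.det_to_matrix_orthonormalBasis`, `AlternatingMap.eq_smul_basis_det`,
`EuclideanSpace.norm_eq`, `Matrix.det_updateCol_sum`, `integral_exp_mul_complex`,
`intervalIntegral.hasSum_integral_of_dominated_convergence`,
`intervalIntegral.intervalIntegral_conj`, `hasSum_nat_add_iff'`, `norm_tsum_le_tsum_norm`.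

## References

* P. Deift, A. Its, I. Krasovsky, Comm. Pure Appl. Math. 66 (2013) 1360–1438, §1 and §5.
* A. Böttcher, B. Silbermann, *Introduction to Large Truncated Toeplitz Matrices* (Springer,
  1999), Ch. 2 (determinants of symbols with nonzero winding number).
-/

noncomputable section

open scoped InnerProductSpace ComplexConjugate
open Module InnerProductSpace Complex MeasureTheory intervalIntegral Finset Filter Topology

namespace Literature.Analysis.Toeplitz

/-! ### Hadamard's inequality -/

/-- **Hadamard's inequality** over `ℂ` (column form): `|det M| ≤ ∏_k ‖M e_k‖₂`. Proof: the
determinant of `M` in the orthonormal basis produced by Gram–Schmidt from the columns is the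
product of the diagonal inner products (Mathlib's `gramSchmidtOrthonormalBasis_det`), each bounded
by the column norm (Cauchy–Schwarz), and the change between orthonormal bases has determinant of
modulus one. [folklore] -/
theorem norm_det_le_prod_norm_col {n : ℕ} (M : Matrix (Fin n) (Fin n) ℂ) :
    ‖M.det‖ ≤ ∏ k, Real.sqrt (∑ j, ‖M j k‖ ^ 2) := by
  classical
  let f : Fin n → EuclideanSpace ℂ (Fin n) := fun k => WithLp.toLp 2 fun j => M j k
  have hf : ∀ k, ‖f k‖ = Real.sqrt (∑ j, ‖M j k‖ ^ 2) := fun k => by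
    rw [EuclideanSpace.norm_eq]
  have hdim : Module.finrank ℂ (EuclideanSpace ℂ (Fin n)) = Fintype.card (Fin n) :=
    finrank_euclideanSpace
  set b := gramSchmidtOrthonormalBasis hdim f with hb
  set e := EuclideanSpace.basisFun (Fin n) ℂ with he
  -- `det M = e.det f`
  have hdet : M.det = e.toBasis.det f := by
    rw [Basis.det_apply]
    rfl
  -- change of orthonormal basis
  have hchange : e.toBasis.det f = e.toBasis.det b * b.toBasis.det f := by
    have h := AlternatingMap.eq_smul_basis_det b.toBasis e.toBasis.det
    have h' := congrArg (fun g : (EuclideanSpace ℂ (Fin n)) [⋀^Fin n]→ₗ[ℂ] ℂ => g f) h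
    simp only [AlternatingMap.smul_apply, smul_eq_mul] at h'
    rw [h']
    rfl
  have hnorm1 : ‖e.toBasis.det b‖ = 1 := e.det_to_matrix_orthonormalBasis b
  rw [hdet, hchange, norm_mul, hnorm1, one_mul, gramSchmidtOrthonormalBasis_det hdim f, norm_prod]
  refine Finset.prod_le_prod (fun k _ => norm_nonneg _) fun k _ => ?_
  rw [← hf k]
  calc ‖⟪b k, f k⟫_ℂ‖ ≤ ‖b k‖ * ‖f k‖ := norm_inner_le_norm _ _
    _ = ‖f k‖ := by rw [b.orthonormal.1 k, one_mul]

/-! ### Elementary API of `circleCoeff` -/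

/-- The Fourier coefficients of a pure exponential: `(e^{imθ})_j = δ_{jm}`. [folklore] -/
theorem circleCoeff_cexp_int_mul (m j : ℤ) :
    circleCoeff (fun θ : ℝ => Complex.exp ((m : ℂ) * θ * I)) j = if j = m then 1 else 0 := by
  -- orthogonality of the exponentials: `∫_{-π}^{π} e^{inθ} dθ = 2π δ_{n0}`
  have horth : ∀ n : ℤ, (∫ θ in (-Real.pi)..Real.pi, Complex.exp ((n : ℂ) * θ * I)) =
      if n = 0 then 2 * (Real.pi : ℂ) else 0 := by
    intro n
    split_ifs with hn
    · subst hn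
      simp [two_mul]
    · have hc : (n : ℂ) * I ≠ 0 := mul_ne_zero (by exact_mod_cast hn) Complex.I_ne_zero
      have h := integral_exp_mul_complex (a := -Real.pi) (b := Real.pi) hc
      have hfun : (fun θ : ℝ => Complex.exp ((n : ℂ) * θ * I)) =
          fun θ : ℝ => Complex.exp ((n : ℂ) * I * θ) := by
        funext θ; ring_nf
      rw [hfun, h]
      have hper : Complex.exp ((n : ℂ) * I * Real.pi) = Complex.exp ((n : ℂ) * I * ↑(-Real.pi)) := by
        have h1 := Complex.exp_int_mul_two_pi_mul_I n
        rw [show (n : ℂ) * I * Real.pi = (n : ℂ) * I * ↑(-Real.pi) + n * (2 * Real.pi * I) by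
          push_cast; ring, Complex.exp_add, h1, mul_one]
      rw [hper, sub_self, zero_div]
  rw [circleCoeff]
  have hfun : (fun θ : ℝ => Complex.exp (-((j : ℂ) * θ * I)) * Complex.exp ((m : ℂ) * θ * I)) =
      fun θ : ℝ => Complex.exp ((((m - j : ℤ)) : ℂ) * θ * I) := by
    funext θ
    rw [← Complex.exp_add]
    congr 1
    push_cast
    ring
  rw [hfun, horth]
  have h2π : (2 * Real.pi : ℂ) ≠ 0 := by exact_mod_cast (mul_pos two_pos Real.pi_pos).ne'
  by_cases hjm : j = m
  · subst hjm
    simp only [sub_self, if_true]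
    exact inv_mul_cancel₀ h2π
  · have : (m - j : ℤ) ≠ 0 := fun h => hjm (by omega)
    rw [if_neg this, if_neg hjm, mul_zero]

/-- **Shift rule**: the `j`-th coefficient of `φ(θ) e^{ikθ}` is `φ_{j-k}`. [folklore] -/
theorem circleCoeff_mul_cexp (φ : ℝ → ℂ) (k j : ℤ) :
    circleCoeff (fun θ : ℝ => φ θ * Complex.exp ((k : ℂ) * θ * I)) j = circleCoeff φ (j - k) := by
  rw [circleCoeff, circleCoeff]
  congr 1
  refine intervalIntegral.integral_congr fun θ _ => ?_
  rw [show Complex.exp (-((j : ℂ) * θ * I)) * (φ θ * Complex.exp ((k : ℂ) * θ * I)) =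
      (Complex.exp (-((j : ℂ) * θ * I)) * Complex.exp ((k : ℂ) * θ * I)) * φ θ by ring,
    ← Complex.exp_add]
  congr 2
  push_cast
  ring

/-- Linearity of `circleCoeff` over finite sums of integrable functions. [folklore] -/
theorem circleCoeff_finset_sum {ι : Type*} (s : Finset ι) (f : ι → ℝ → ℂ)
    (hf : ∀ i ∈ s, Continuous (f i)) (j : ℤ) :
    circleCoeff (fun θ => ∑ i ∈ s, f i θ) j = ∑ i ∈ s, circleCoeff (f i) j := by
  simp only [circleCoeff]
  have hint : ∀ i ∈ s, IntervalIntegrable (fun θ : ℝ => Complex.exp (-((j : ℂ) * θ * I)) * f i θ)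
      volume (-Real.pi) Real.pi := fun i hi =>
    (Continuous.intervalIntegrable (by have := hf i hi; fun_prop) _ _)
  have h : (∫ θ in (-Real.pi)..Real.pi, Complex.exp (-((j : ℂ) * θ * I)) * ∑ i ∈ s, f i θ) =
      ∑ i ∈ s, ∫ θ in (-Real.pi)..Real.pi, Complex.exp (-((j : ℂ) * θ * I)) * f i θ := by
    rw [← intervalIntegral.integral_finsetSum hint]
    refine intervalIntegral.integral_congr fun θ _ => ?_
    simp only [Finset.mul_sum]
  rw [h, Finset.mul_sum]

/-- `circleCoeff (f - g) = circleCoeff f - circleCoeff g` for continuous `f, g`. [folklore] -/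
theorem circleCoeff_sub {f g : ℝ → ℂ} (hf : Continuous f) (hg : Continuous g) (j : ℤ) :
    circleCoeff (fun θ => f θ - g θ) j = circleCoeff f j - circleCoeff g j := by
  simp only [circleCoeff]
  rw [← mul_sub, ← intervalIntegral.integral_sub]
  · congr 1
    refine intervalIntegral.integral_congr fun θ _ => ?_
    simp only [mul_sub]
  · exact (Continuous.intervalIntegrable (by fun_prop) _ _)
  · exact (Continuous.intervalIntegrable (by fun_prop) _ _)

/-- `circleCoeff (c f) = c · circleCoeff f`. [folklore] -/
theorem circleCoeff_const_mul (c : ℂ) (f : ℝ → ℂ) (j : ℤ) :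
    circleCoeff (fun θ => c * f θ) j = c * circleCoeff f j := by
  simp only [circleCoeff]
  rw [← intervalIntegral.integral_const_mul, ← intervalIntegral.integral_const_mul,
    ← intervalIntegral.integral_const_mul]
  refine intervalIntegral.integral_congr fun θ _ => ?_
  ring

/-- The defining integral: `∫_{-π}^{π} e^{-ijθ} f(θ) dθ = 2π f_j`. [folklore] -/
theorem integral_cexp_neg_mul_eq (f : ℝ → ℂ) (j : ℤ) :
    (∫ θ in (-Real.pi)..Real.pi, Complex.exp (-((j : ℂ) * θ * I)) * f θ) =
      2 * Real.pi * circleCoeff f j := by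
  have h2π : (2 * Real.pi : ℂ) ≠ 0 := by exact_mod_cast (mul_pos two_pos Real.pi_pos).ne'
  rw [circleCoeff, ← mul_assoc, mul_inv_cancel₀ h2π, one_mul]

/-- A coefficient is bounded by the sup norm: `‖f_j‖ ≤ B` if `‖f‖ ≤ B` on `[-π, π]`. [folklore] -/
theorem norm_circleCoeff_le {f : ℝ → ℂ} {B : ℝ} (hB : ∀ θ, ‖f θ‖ ≤ B) (j : ℤ) :
    ‖circleCoeff f j‖ ≤ B := by
  have hB0 : 0 ≤ B := (norm_nonneg _).trans (hB 0)
  rw [circleCoeff, norm_mul]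
  have h1 : ‖∫ θ in (-Real.pi)..Real.pi, Complex.exp (-((j : ℂ) * θ * I)) * f θ‖ ≤
      B * |Real.pi - -Real.pi| := by
    refine intervalIntegral.norm_integral_le_of_norm_le_const fun θ _ => ?_
    rw [norm_mul, show -((j : ℂ) * θ * I) = ((-(j * θ) : ℝ) : ℂ) * I by push_cast; ring,
      Complex.norm_exp_ofReal_mul_I, one_mul]
    exact hB θ
  have h2 : ‖(2 * Real.pi : ℂ)⁻¹‖ = (2 * Real.pi)⁻¹ := by
    rw [norm_inv]
    congr 1
    exact_mod_cast Real.norm_of_nonneg (mul_pos two_pos Real.pi_pos).le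
  rw [h2]
  have hpi : |Real.pi - -Real.pi| = 2 * Real.pi := by
    rw [sub_neg_eq_add, ← two_mul, abs_of_pos (mul_pos two_pos Real.pi_pos)]
  rw [hpi] at h1
  calc (2 * Real.pi)⁻¹ * ‖∫ θ in (-Real.pi)..Real.pi, Complex.exp (-((j : ℂ) * θ * I)) * f θ‖
      ≤ (2 * Real.pi)⁻¹ * (B * (2 * Real.pi)) :=
        mul_le_mul_of_nonneg_left h1 (inv_nonneg.2 (mul_pos two_pos Real.pi_pos).le)
    _ = B := by field_simp

/-! ### Bessel's inequality -/

/-- `conj (e^{imθ}) = e^{-imθ}` for real `θ` and integer `m`. [folklore] -/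
theorem conj_cexp_int_mul (m : ℤ) (θ : ℝ) :
    conj (Complex.exp ((m : ℂ) * θ * I)) = Complex.exp (-((m : ℂ) * θ * I)) := by
  rw [← Complex.exp_conj, map_mul, map_mul, Complex.conj_ofReal, Complex.conj_I, map_intCast]
  congr 1
  ring

/-- `conj z * z = ‖z‖²` as a real number cast to `ℂ`. [folklore] -/
theorem conj_mul_eq_ofReal_norm_sq (z : ℂ) : conj z * z = ((‖z‖ ^ 2 : ℝ) : ℂ) := by
  rw [Complex.conj_mul', Complex.ofReal_pow]

/-- **Bessel's inequality** for the Fourier coefficients on `[-π, π]` (finite form): for a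
continuous `f : ℝ → ℂ` and a finite set `S ⊆ ℤ`, `2π ∑_{m ∈ S} ‖f_m‖² ≤ ∫_{-π}^{π} ‖f(θ)‖² dθ`
(expand `0 ≤ ∫ ‖f − ∑_{m∈S} f_m e^{imθ}‖²` with the orthogonality of the exponentials). [folklore] -/
theorem two_pi_mul_sum_norm_sq_circleCoeff_le {f : ℝ → ℂ} (hf : Continuous f) (S : Finset ℤ) :
    2 * Real.pi * ∑ m ∈ S, ‖circleCoeff f m‖ ^ 2 ≤ ∫ θ in (-Real.pi)..Real.pi, ‖f θ‖ ^ 2 := by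
  set c : ℤ → ℂ := circleCoeff f with hc
  set P : ℝ → ℂ := fun θ => ∑ m ∈ S, c m * Complex.exp ((m : ℂ) * θ * I) with hP
  have hPc : Continuous P := by
    rw [hP]
    fun_prop
  set X : ℂ := 2 * Real.pi * ∑ m ∈ S, ((‖c m‖ ^ 2 : ℝ) : ℂ) with hX
  -- (i) `∫ conj(P) f = X`
  have hconjP : ∀ θ : ℝ, conj (P θ) = ∑ m ∈ S, conj (c m) * Complex.exp (-((m : ℂ) * θ * I)) := by
    intro θ
    rw [hP]
    simp only [map_sum, map_mul, conj_cexp_int_mul]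
  have hPf : (∫ θ in (-Real.pi)..Real.pi, conj (P θ) * f θ) = X := by
    have hfun : (fun θ : ℝ => conj (P θ) * f θ) =
        fun θ : ℝ => ∑ m ∈ S, conj (c m) * (Complex.exp (-((m : ℂ) * θ * I)) * f θ) := by
      funext θ
      rw [hconjP, Finset.sum_mul]
      refine Finset.sum_congr rfl fun m _ => ?_
      ring
    have hint : ∀ m ∈ S, IntervalIntegrable
        (fun θ : ℝ => conj (c m) * (Complex.exp (-((m : ℂ) * θ * I)) * f θ)) volume
        (-Real.pi) Real.pi := fun m _ => (Continuous.intervalIntegrable (by fun_prop) _ _)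
    rw [hfun, intervalIntegral.integral_finsetSum hint, hX, Finset.mul_sum]
    refine Finset.sum_congr rfl fun m _ => ?_
    rw [intervalIntegral.integral_const_mul, integral_cexp_neg_mul_eq, ← hc,
      show conj (c m) * (2 * Real.pi * c m) = 2 * Real.pi * (conj (c m) * c m) by ring,
      conj_mul_eq_ofReal_norm_sq]
  -- (ii) `∫ conj(f) P = X`
  have hfP : (∫ θ in (-Real.pi)..Real.pi, conj (f θ) * P θ) = X := by
    have hfun : (fun θ : ℝ => conj (f θ) * P θ) = fun θ : ℝ => conj (conj (P θ) * f θ) := by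
      funext θ
      rw [map_mul, conj_conj, mul_comm]
    rw [hfun, intervalIntegral.intervalIntegral_conj, hPf, hX]
    simp only [map_mul, map_sum, Complex.conj_ofReal, map_ofNat]
  -- (iii) `∫ conj(P) P = X`
  have hPP : (∫ θ in (-Real.pi)..Real.pi, conj (P θ) * P θ) = X := by
    have hfun : (fun θ : ℝ => conj (P θ) * P θ) = fun θ : ℝ => ∑ m ∈ S, ∑ m' ∈ S,
        conj (c m) * c m' * (Complex.exp (-((m : ℂ) * θ * I)) * Complex.exp ((m' : ℂ) * θ * I)) := by
      funext θ
      rw [hconjP, hP, Finset.sum_mul_sum]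
      refine Finset.sum_congr rfl fun m _ => Finset.sum_congr rfl fun m' _ => ?_
      ring
    have hint : ∀ m ∈ S, IntervalIntegrable (fun θ : ℝ => ∑ m' ∈ S,
        conj (c m) * c m' * (Complex.exp (-((m : ℂ) * θ * I)) * Complex.exp ((m' : ℂ) * θ * I)))
        volume (-Real.pi) Real.pi :=
      fun m _ => (Continuous.intervalIntegrable (by fun_prop) _ _)
    have hint' : ∀ m ∈ S, ∀ m' ∈ S, IntervalIntegrable (fun θ : ℝ =>
        conj (c m) * c m' * (Complex.exp (-((m : ℂ) * θ * I)) * Complex.exp ((m' : ℂ) * θ * I)))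
        volume (-Real.pi) Real.pi :=
      fun m _ m' _ => (Continuous.intervalIntegrable (by fun_prop) _ _)
    rw [hfun, intervalIntegral.integral_finsetSum hint, hX, Finset.mul_sum]
    refine Finset.sum_congr rfl fun m hm => ?_
    rw [intervalIntegral.integral_finsetSum (hint' m hm)]
    have hterm : ∀ m' ∈ S, (∫ θ in (-Real.pi)..Real.pi,
        conj (c m) * c m' * (Complex.exp (-((m : ℂ) * θ * I)) * Complex.exp ((m' : ℂ) * θ * I))) =
        if m' = m then 2 * Real.pi * (conj (c m) * c m) else 0 := by
      intro m' _
      rw [intervalIntegral.integral_const_mul, integral_cexp_neg_mul_eq, circleCoeff_cexp_int_mul]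
      by_cases h : m' = m
      · subst h; simp; ring
      · rw [if_neg (Ne.symm h), if_neg h, mul_zero, mul_zero]
    rw [Finset.sum_congr rfl hterm, Finset.sum_ite_eq' S m, if_pos hm, conj_mul_eq_ofReal_norm_sq]
  -- (iv) `∫ conj(f) f = ∫ ‖f‖²` and the expansion of `∫ ‖f − P‖²`
  have hff : (∫ θ in (-Real.pi)..Real.pi, conj (f θ) * f θ) =
      ((∫ θ in (-Real.pi)..Real.pi, ‖f θ‖ ^ 2 : ℝ) : ℂ) := by
    rw [← intervalIntegral.integral_ofReal]
    exact intervalIntegral.integral_congr fun θ _ => conj_mul_eq_ofReal_norm_sq (f θ)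
  have hdd : (∫ θ in (-Real.pi)..Real.pi, conj (f θ - P θ) * (f θ - P θ)) =
      ((∫ θ in (-Real.pi)..Real.pi, ‖f θ - P θ‖ ^ 2 : ℝ) : ℂ) := by
    rw [← intervalIntegral.integral_ofReal]
    exact intervalIntegral.integral_congr fun θ _ => conj_mul_eq_ofReal_norm_sq (f θ - P θ)
  have hexpand : (∫ θ in (-Real.pi)..Real.pi, conj (f θ - P θ) * (f θ - P θ)) =
      (∫ θ in (-Real.pi)..Real.pi, conj (f θ) * f θ) -
        (∫ θ in (-Real.pi)..Real.pi, conj (f θ) * P θ) -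
        (∫ θ in (-Real.pi)..Real.pi, conj (P θ) * f θ) +
        (∫ θ in (-Real.pi)..Real.pi, conj (P θ) * P θ) := by
    have i1 : IntervalIntegrable (fun θ : ℝ => conj (f θ) * f θ) volume (-Real.pi) Real.pi :=
      (Continuous.intervalIntegrable (by fun_prop) _ _)
    have i2 : IntervalIntegrable (fun θ : ℝ => conj (f θ) * P θ) volume (-Real.pi) Real.pi :=
      (Continuous.intervalIntegrable (by fun_prop) _ _)
    have i3 : IntervalIntegrable (fun θ : ℝ => conj (P θ) * f θ) volume (-Real.pi) Real.pi :=
      (Continuous.intervalIntegrable (by fun_prop) _ _)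
    have i4 : IntervalIntegrable (fun θ : ℝ => conj (P θ) * P θ) volume (-Real.pi) Real.pi :=
      (Continuous.intervalIntegrable (by fun_prop) _ _)
    rw [← intervalIntegral.integral_sub i1 i2, ← intervalIntegral.integral_sub (i1.sub i2) i3,
      ← intervalIntegral.integral_add ((i1.sub i2).sub i3) i4]
    refine intervalIntegral.integral_congr fun θ _ => ?_
    simp only [map_sub]
    ring
  have hreal : (∫ θ in (-Real.pi)..Real.pi, ‖f θ - P θ‖ ^ 2) =
      (∫ θ in (-Real.pi)..Real.pi, ‖f θ‖ ^ 2) - 2 * Real.pi * ∑ m ∈ S, ‖c m‖ ^ 2 := by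
    have h := hexpand
    rw [hdd, hff, hfP, hPf, hPP, hX] at h
    have h' : ((∫ θ in (-Real.pi)..Real.pi, ‖f θ - P θ‖ ^ 2 : ℝ) : ℂ) =
        (((∫ θ in (-Real.pi)..Real.pi, ‖f θ‖ ^ 2) - 2 * Real.pi * ∑ m ∈ S, ‖c m‖ ^ 2 : ℝ) : ℂ) := by
      rw [h]; push_cast; ring
    exact_mod_cast h'
  have hnonneg : 0 ≤ ∫ θ in (-Real.pi)..Real.pi, ‖f θ - P θ‖ ^ 2 :=
    intervalIntegral.integral_nonneg (by linarith [Real.pi_pos]) fun θ _ => by positivity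
  rw [hreal] at hnonneg
  linarith

/-! ### The decay bound -/

/-- **No nonnegative modes**: if `G(θ) = ∑_{k ≥ 0} g_k e^{-i(k+1)θ}` with `∑ ‖g_k‖ < ∞`, then
`G_j = 0` for every `j ≥ 0` (termwise integration, dominated by `‖g_k‖`). [folklore] -/
theorem circleCoeff_natCast_eq_zero_of_hasSum {g : ℕ → ℂ} (hg : Summable fun k => ‖g k‖)
    {G : ℝ → ℂ}
    (hG : ∀ θ : ℝ, HasSum (fun k : ℕ => g k * Complex.exp (-(((k : ℂ) + 1) * θ * I))) (G θ))
    (j : ℕ) : circleCoeff G j = 0 := by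
  have hs : HasSum (fun k : ℕ => ∫ θ in (-Real.pi)..Real.pi,
      Complex.exp (-(((j : ℤ) : ℂ) * θ * I)) * (g k * Complex.exp (-(((k : ℂ) + 1) * θ * I))))
      (∫ θ in (-Real.pi)..Real.pi, Complex.exp (-(((j : ℤ) : ℂ) * θ * I)) * G θ) := by
    refine intervalIntegral.hasSum_integral_of_dominated_convergence (fun k _ => ‖g k‖)
      (fun k => Continuous.aestronglyMeasurable (by fun_prop)) (fun k => ?_) ?_ ?_ ?_
    · refine Filter.Eventually.of_forall fun θ _ => ?_
      rw [norm_mul, norm_mul, show -(((j : ℤ) : ℂ) * θ * I) = ((-(j * θ) : ℝ) : ℂ) * I by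
          push_cast; ring, Complex.norm_exp_ofReal_mul_I, one_mul,
        show -(((k : ℂ) + 1) * θ * I) = ((-((k + 1) * θ) : ℝ) : ℂ) * I by push_cast; ring,
        Complex.norm_exp_ofReal_mul_I, mul_one]
    · exact Filter.Eventually.of_forall fun θ _ => hg
    · exact intervalIntegrable_const
    · exact Filter.Eventually.of_forall fun θ _ => (hG θ).mul_left _
  have hterm : (fun k : ℕ => ∫ θ in (-Real.pi)..Real.pi,
      Complex.exp (-(((j : ℤ) : ℂ) * θ * I)) * (g k * Complex.exp (-(((k : ℂ) + 1) * θ * I)))) =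
      fun _ => 0 := by
    funext k
    have hfun : (fun θ : ℝ => Complex.exp (-(((j : ℤ) : ℂ) * θ * I)) *
        (g k * Complex.exp (-(((k : ℂ) + 1) * θ * I)))) =
        fun θ : ℝ => g k * (Complex.exp (-(((j : ℤ) : ℂ) * θ * I)) *
          Complex.exp ((((-((k : ℤ) + 1) : ℤ)) : ℂ) * θ * I)) := by
      funext θ
      rw [show (((-((k : ℤ) + 1) : ℤ)) : ℂ) * θ * I = -(((k : ℂ) + 1) * θ * I) by push_cast; ring]
      ring
    rw [hfun, intervalIntegral.integral_const_mul, integral_cexp_neg_mul_eq, circleCoeff_cexp_int_mul,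
      if_neg (by omega), mul_zero, mul_zero]
  rw [hterm] at hs
  have h0 : (∫ θ in (-Real.pi)..Real.pi, Complex.exp (-(((j : ℤ) : ℂ) * θ * I)) * G θ) = 0 :=
    hs.unique hasSum_zero
  rw [circleCoeff, h0, mul_zero]

/-- The tail of an absolutely convergent exponential series is bounded by the tail sum:
`‖H(θ) − ∑_{k<n} h_k e^{ikθ}‖ ≤ ∑_{k} ‖h_{k+n}‖`. [folklore] -/
theorem norm_sub_partial_sum_le {h : ℕ → ℂ} (hs : Summable fun k => ‖h k‖) {H : ℝ → ℂ}
    (hH : ∀ θ : ℝ, HasSum (fun k : ℕ => h k * Complex.exp ((k : ℂ) * θ * I)) (H θ)) (n : ℕ)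
    (θ : ℝ) :
    ‖H θ - ∑ k ∈ Finset.range n, h k * Complex.exp ((k : ℂ) * θ * I)‖ ≤ ∑' k, ‖h (k + n)‖ := by
  have htail : HasSum (fun k : ℕ => h (k + n) * Complex.exp ((((k + n : ℕ)) : ℂ) * θ * I))
      (H θ - ∑ k ∈ Finset.range n, h k * Complex.exp ((k : ℂ) * θ * I)) :=
    (hasSum_nat_add_iff' n).2 (hH θ)
  rw [← htail.tsum_eq]
  have hs' : Summable fun k : ℕ => ‖h (k + n) * Complex.exp ((((k + n : ℕ)) : ℂ) * θ * I)‖ := by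
    have h1 : Summable fun k : ℕ => ‖h (k + n)‖ := (summable_nat_add_iff n).2 hs
    refine h1.congr fun k => ?_
    rw [norm_mul, show (((k + n : ℕ)) : ℂ) * θ * I = ((((k + n : ℕ) : ℝ) * θ : ℝ) : ℂ) * I by
      push_cast; ring, Complex.norm_exp_ofReal_mul_I, mul_one]
  refine (norm_tsum_le_tsum_norm hs').trans (le_of_eq (tsum_congr fun k => ?_))
  rw [norm_mul, show (((k + n : ℕ)) : ℂ) * θ * I = ((((k + n : ℕ) : ℝ) * θ : ℝ) : ℂ) * I by
    push_cast; ring, Complex.norm_exp_ofReal_mul_I, mul_one]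

/-- The column sums of squares of a Toeplitz matrix of Fourier coefficients of a symbol bounded by
`1` are at most `1` (Bessel). [folklore] -/
theorem sum_norm_sq_toeplitzMatrix_col_le_one {φ : ℝ → ℂ} (hφc : Continuous φ)
    (hφ1 : ∀ θ, ‖φ θ‖ ≤ 1) (n : ℕ) (k : Fin n) :
    ∑ j : Fin n, ‖toeplitzMatrix (circleCoeff φ) n j k‖ ^ 2 ≤ 1 := by
  have hinj : Function.Injective fun j : Fin n => (j : ℤ) - (k : ℤ) := by
    intro a b hab
    exact Fin.ext (by simpa using hab)
  have hsum : ∑ j : Fin n, ‖toeplitzMatrix (circleCoeff φ) n j k‖ ^ 2 =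
      ∑ m ∈ Finset.univ.image (fun j : Fin n => (j : ℤ) - (k : ℤ)), ‖circleCoeff φ m‖ ^ 2 := by
    rw [Finset.sum_image fun a _ b _ hab => hinj hab]
    simp only [toeplitzMatrix_apply]
  rw [hsum]
  have hB := two_pi_mul_sum_norm_sq_circleCoeff_le hφc
    (Finset.univ.image fun j : Fin n => (j : ℤ) - (k : ℤ))
  have hint : (∫ θ in (-Real.pi)..Real.pi, ‖φ θ‖ ^ 2) ≤ 2 * Real.pi := by
    have h := intervalIntegral.integral_mono_on (μ := volume) (a := -Real.pi) (b := Real.pi)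
      (by linarith [Real.pi_pos])
      ((Continuous.intervalIntegrable (by fun_prop) _ _)) intervalIntegrable_const
      (fun θ _ => show ‖φ θ‖ ^ 2 ≤ (1 : ℝ) from by
        have := hφ1 θ; have := norm_nonneg (φ θ); nlinarith)
    rw [intervalIntegral.integral_const, smul_eq_mul, mul_one, sub_neg_eq_add, ← two_mul] at h
    exact h
  nlinarith [Real.pi_pos, Finset.sum_nonneg fun m (_ : m ∈ Finset.univ.image
    fun j : Fin n => (j : ℤ) - (k : ℤ)) => sq_nonneg ‖circleCoeff φ m‖]

/-- **Decay of Toeplitz determinants from an approximate kernel vector** (the elementary bound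
behind the exponential decay of `D_n(φ)` for symbols of negative winding): let `φ` be a continuous
symbol with `|φ| ≤ 1` and `H(θ) = ∑_{k ≥ 0} h_k e^{ikθ}` an absolutely convergent series such that
`φ H` has no Fourier modes of index `≥ 0`. Then `|D_n(φ)| · |h_0| ≤ ∑_{k ≥ n} |h_k|` for every
`n`: replacing the first column of `T_n(φ)` by `T_n(φ) (h_0, …, h_{n-1})ᵀ = −((φ R_n)_j)_j`,
`R_n = ∑_{k ≥ n} h_k e^{ikθ}`, multiplies the determinant by `h_0`, and Hadamard's inequality with
Bessel's inequality for the columns gives the bound. [folklore] -/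
theorem norm_toeplitzDet_mul_norm_le_tsum {φ H : ℝ → ℂ} (hφc : Continuous φ)
    (hφ1 : ∀ θ, ‖φ θ‖ ≤ 1) (hHc : Continuous H) {h : ℕ → ℂ} (hs : Summable fun k => ‖h k‖)
    (hH : ∀ θ : ℝ, HasSum (fun k : ℕ => h k * Complex.exp ((k : ℂ) * θ * I)) (H θ))
    (hvan : ∀ j : ℕ, circleCoeff (fun θ => φ θ * H θ) j = 0) (n : ℕ) :
    ‖toeplitzDet (circleCoeff φ) n‖ * ‖h 0‖ ≤ ∑' k, ‖h (k + n)‖ := by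
  rcases Nat.eq_zero_or_pos n with rfl | hn
  · rw [toeplitzDet_zero, norm_one, one_mul]
    simpa using hs.le_tsum 0 (fun j _ => norm_nonneg _)
  obtain ⟨m, rfl⟩ : ∃ m, n = m + 1 := ⟨n - 1, by omega⟩
  set τ : ℝ := ∑' k, ‖h (k + (m + 1))‖ with hτ
  have hτ0 : 0 ≤ τ := tsum_nonneg fun k => norm_nonneg _
  set c : ℤ → ℂ := circleCoeff φ with hc
  set T : Matrix (Fin (m + 1)) (Fin (m + 1)) ℂ := toeplitzMatrix c (m + 1) with hT
  set v : Fin (m + 1) → ℂ := fun k => h k with hv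
  -- the modified matrix
  set T' : Matrix (Fin (m + 1)) (Fin (m + 1)) ℂ := T.updateCol 0 (fun j => ∑ i, v i • T j i)
    with hT'
  have hdet : T'.det = v 0 • T.det := Matrix.det_updateCol_sum T 0 v
  -- the trigonometric polynomial `V` and the remainder `R`
  set V : ℝ → ℂ := fun θ => ∑ k ∈ Finset.range (m + 1), h k * Complex.exp ((k : ℂ) * θ * I) with hV
  have hVc : Continuous V := by rw [hV]; fun_prop
  set R : ℝ → ℂ := fun θ => H θ - V θ with hR
  have hRc : Continuous R := hHc.sub hVc
  have hRle : ∀ θ, ‖R θ‖ ≤ τ := fun θ => norm_sub_partial_sum_le hs hH (m + 1) θ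
  -- the new first column is `-(φ R)_j`
  have hcol : ∀ j : Fin (m + 1), ∑ i, v i • T j i = -circleCoeff (fun θ => φ θ * R θ) (j : ℕ) := by
    intro j
    have h1 : circleCoeff (fun θ => φ θ * V θ) ((j : ℕ) : ℤ) = ∑ i : Fin (m + 1), v i • T j i := by
      have hfun : (fun θ => φ θ * V θ) = fun θ => ∑ k ∈ Finset.range (m + 1),
          h k * (φ θ * Complex.exp ((k : ℂ) * θ * I)) := by
        funext θ
        rw [hV, Finset.mul_sum]
        refine Finset.sum_congr rfl fun k _ => ?_
        ring
      rw [hfun, circleCoeff_finset_sum _ _ (fun k _ => by fun_prop), ← Fin.sum_univ_eq_sum_range]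
      refine Finset.sum_congr rfl fun i _ => ?_
      rw [circleCoeff_const_mul, show ((i : ℕ) : ℂ) = ((i : ℕ) : ℤ) by push_cast; rfl,
        circleCoeff_mul_cexp, hv, hT, toeplitzMatrix_apply, smul_eq_mul]
    have h2 : circleCoeff (fun θ => φ θ * V θ) ((j : ℕ) : ℤ) =
        circleCoeff (fun θ => φ θ * H θ) ((j : ℕ) : ℤ) - circleCoeff (fun θ => φ θ * R θ) ((j : ℕ) : ℤ) := by
      rw [← circleCoeff_sub (by fun_prop) (by fun_prop)]
      congr 1
      funext θ
      rw [hR]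
      ring
    rw [← h1, h2, hvan, zero_sub]
  -- column norms of `T'`
  have hcol0 : ∑ j : Fin (m + 1), ‖T' j 0‖ ^ 2 ≤ τ ^ 2 := by
    have hrw : ∑ j : Fin (m + 1), ‖T' j 0‖ ^ 2 =
        ∑ j' ∈ Finset.univ.image (fun j : Fin (m + 1) => ((j : ℕ) : ℤ)),
          ‖circleCoeff (fun θ => φ θ * R θ) j'‖ ^ 2 := by
      rw [Finset.sum_image fun a _ b _ hab => Fin.ext (by exact_mod_cast hab)]
      refine Finset.sum_congr rfl fun j _ => ?_
      rw [hT', Matrix.updateCol_self, hcol j, norm_neg]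
    rw [hrw]
    have hB := two_pi_mul_sum_norm_sq_circleCoeff_le (f := fun θ => φ θ * R θ) (by fun_prop)
      (Finset.univ.image (fun j : Fin (m + 1) => ((j : ℕ) : ℤ)))
    have hint : (∫ θ in (-Real.pi)..Real.pi, ‖φ θ * R θ‖ ^ 2) ≤ 2 * Real.pi * τ ^ 2 := by
      have h := intervalIntegral.integral_mono_on (μ := volume) (a := -Real.pi) (b := Real.pi)
        (by linarith [Real.pi_pos])
        ((Continuous.intervalIntegrable (by fun_prop) _ _)) intervalIntegrable_const
        (fun θ _ => show ‖φ θ * R θ‖ ^ 2 ≤ τ ^ 2 from by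
          rw [norm_mul]
          have h1 := hφ1 θ; have h2 := hRle θ; have h3 := norm_nonneg (φ θ)
          have h4 := norm_nonneg (R θ)
          have : ‖φ θ‖ * ‖R θ‖ ≤ τ := by nlinarith
          exact pow_le_pow_left₀ (by positivity) this 2)
      rw [intervalIntegral.integral_const, smul_eq_mul, sub_neg_eq_add] at h
      linarith
    nlinarith [Real.pi_pos, Finset.sum_nonneg fun j' (_ : j' ∈ Finset.univ.image
      fun j : Fin (m + 1) => ((j : ℕ) : ℤ)) => sq_nonneg ‖circleCoeff (fun θ => φ θ * R θ) j'‖]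
  have hcolk : ∀ k : Fin (m + 1), k ≠ 0 → ∑ j : Fin (m + 1), ‖T' j k‖ ^ 2 ≤ 1 := by
    intro k hk
    have hrw : ∑ j : Fin (m + 1), ‖T' j k‖ ^ 2 = ∑ j : Fin (m + 1), ‖T j k‖ ^ 2 := by
      refine Finset.sum_congr rfl fun j _ => ?_
      rw [hT', Matrix.updateCol_ne hk]
    rw [hrw, hT, hc]
    exact sum_norm_sq_toeplitzMatrix_col_le_one hφc hφ1 (m + 1) k
  -- Hadamard
  have hH' := norm_det_le_prod_norm_col T'
  have hprod : ∏ k : Fin (m + 1), Real.sqrt (∑ j, ‖T' j k‖ ^ 2) ≤ τ := by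
    rw [Fin.prod_univ_succ]
    have h0 : Real.sqrt (∑ j, ‖T' j 0‖ ^ 2) ≤ τ := by
      rw [← Real.sqrt_sq hτ0]
      exact Real.sqrt_le_sqrt hcol0
    have h1 : ∏ i : Fin m, Real.sqrt (∑ j, ‖T' j i.succ‖ ^ 2) ≤ 1 := by
      refine Finset.prod_le_one (fun i _ => Real.sqrt_nonneg _) fun i _ => ?_
      rw [← Real.sqrt_one]
      exact Real.sqrt_le_sqrt (hcolk i.succ (Fin.succ_ne_zero i))
    calc Real.sqrt (∑ j, ‖T' j 0‖ ^ 2) * ∏ i : Fin m, Real.sqrt (∑ j, ‖T' j i.succ‖ ^ 2)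
        ≤ τ * 1 := mul_le_mul h0 h1 (Finset.prod_nonneg fun i _ => Real.sqrt_nonneg _) hτ0
      _ = τ := mul_one τ
  have hkey : ‖T'.det‖ ≤ τ := hH'.trans hprod
  rw [hdet, norm_smul, mul_comm] at hkey
  rw [toeplitzDet]
  exact hkey

end Literature.Analysis.Toeplitz
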